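import Summits.QuantumFields.BalabanUV.T4Continuum.Support.VariationalVectorGaugeSliceFlat

/-!
# T⁴ programme, spine node NE2 (U1a), lane P2 — LEAF V-GF, file 5: DECISION (D1) AS A THEOREM AT `U = 1` — the block-spin VALUE of Bałaban's
# gauge-fixed vector form `½curlSq + projG 1 (ker Q′_1)` over every fibre of the flat average EQUALS the gauge-invariant value of the pure curl form
# («at U = 1 the printed `R∂*A = 0` selects the minimiser, not the value», skeleton §2.E (D1)) — from (SLICE) with `σ′ = σ = 0` (file 2); model level

NE2 formalisation swarm `b2b-balaban-t4-ne2-formalise-*`, leaf prover 09 GEN 7 (`prover-b2b-balaban-t4-ne2-formalise-leaf-09-g7-0`); follows files 1–4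
(`VariationalVectorGaugeSlice{,Flat,B5,Tower}`, p221888 ∕ p222324 ∕ p222476 ∕ p222627).  On top of `VariationalTransfer.{blockSpin, blockSpin_le, le_blockSpin,
blockSpin_mono, fib}` (p206937) and file 2's `slice_flat` — BY NAME.

THE STATEMENTS (model level).
 * §1 ABSTRACT **`blockSpin_eq_of_slice`**: for any constraint map `Q`, any two actions `Scc ≤ Sc` with `0 ≤ Scc`, a zero-cost slice
   `∀ f, ∃ g, Q g = Q f ∧ Sc g ≤ Scc f` forces `blockSpin Q Sc μ = blockSpin Q Scc μ` for EVERY `μ` (empty fibres included) — the gauge functional changes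
   the minimiser, never the value;
 * §2 AT `U = 1` (`E` a finite-dimensional Hilbert space, every level `n`, every torus `M`): **`blockSpin_projG_flat_eq`** ∕ `blockSpin_projG_flat_eq'`:
   `blockSpin (QvL n M 1) (ScV n M 1 (projG 1 (ker Q′_1))) φ = blockSpin (QvL n M 1) (ScV n M 1 0) φ` (flat product line transports `lineT 1 1`, resp. the
   constant transports) — [B5]'s gauge term `‖(I − P)∂*A‖²` ((1.69)–(1.70), via files 1–3) does not change the value `⟨B, Δ_k B⟩`-type infimum of `½‖∂A‖²`
   over `{Q_k A = B}` ((1.47)–(1.48)'s «configuration A minimizing ½⟨∂A,∂A⟩ under Q_kA = B, R∂*A = 0»: the second condition is a SELECTION).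
LOCATED REMARK (docstring only, for the V-END census; journal 2026-08-20 leaf-09-g7): the slice END's fine-level V-ONE route through a displayed (SLICE′)
«`∀ W′ ∃ V′, Q₁V′ = Q₁W′ ∧ SfV 1 G′ V′ ≤ SfV 1 0 W′`» (one-step fibres) does NOT have a `σ′ = 0` inhabitant at `U = 1` for the END's FORCED fine functional
`G′ k =` pullback of `projG_{L^{k+1}} 1 (ker Q′_{L^{k+1}})` once `k ≥ 1`: the zero-curl-cost moves preserving a `Q_L`-fibre are `D_1(ker Q′_L)` and only
remove the `Δ(ker Q′_L)`-component of the divergence, a PROPER subspace of `Δ(ker Q′_{L^{k+1}}∘sites)` (dimension count) — what V-ONE needs there is an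
interpolation estimate for slice minimisers, not a slice; see the journal note.  Nothing of this remark is used or asserted in the kernel below.

HONEST FRAMING (T4-DAG p. 1).  Model level; [folklore] order bookkeeping on `sInf`; nothing printed is a hypothesis; no `def`, no `def … : Prop`, no `sorry`;
axioms standard.  V-GF∕V-P with background OPEN; V-END ∕ NE2 NOT proved; NE3 OPEN; spine PROVED 0∕9 unchanged; rung (B)+1 finite T⁴ — NOT infinite volume,
NOT mass gap, NOT Clay.  HONEST DEPENDENCY (cell, verbatim): continuum YM on T⁴ ⇐ BetaPertH ∧ nine spine estimates (0/9 proved); BetaPertH ⇐ (D1) ∧ (D4) ∧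
CAP+tail; G-an2-4 gates asym, D1 and NE2/3/4.
-/

noncomputable section

namespace Summit.QuantumFields.BalabanUV.T4Continuum.VariationalVectorGaugeSliceValue

open Literature.MathematicalPhysics.QuantumFieldTheory.Balaban1983to89.B5Prop11Plancherel (Tor fine)
open Summit.QuantumFields.BalabanUV.T4Continuum.VariationalTransfer (blockSpin blockSpin_le le_blockSpin blockSpin_mono fib)
open Summit.QuantumFields.BalabanUV.T4Continuum.VariationalVectorForm (curlSq ScV curlSq_nonneg ScV_nonneg)
open Summit.QuantumFields.BalabanUV.T4Continuum.VectorBlockTrialForm (QvL)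
open Summit.QuantumFields.BalabanUV.T4Continuum.VariationalVectorFederbush (lineT)
open Summit.QuantumFields.BalabanUV.T4Continuum.VariationalVectorGaugeSlice (projG projG_nonneg lineT_flat)
open Summit.QuantumFields.BalabanUV.T4Continuum.VariationalVectorGaugeSliceFlat (kerAvgFlat slice_flat)

/-! ## §1 A zero-cost slice does not change the block-spin value -/

section Abstract

variable {V W : Type*} {Q : V → W} {Sc Scc : V → ℝ}

/-- **A ZERO-COST SLICE DOES NOT CHANGE THE VALUE**: `Scc ≤ Sc`, `0 ≤ Scc`, and `∀ f ∃ g, Q g = Q f ∧ Sc g ≤ Scc f` ⟹ `blockSpin Q Sc μ = blockSpin Q Scc μ`.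
[folklore] -/
theorem blockSpin_eq_of_slice (hScc0 : ∀ f, 0 ≤ Scc f) (hle : ∀ f, Scc f ≤ Sc f) (hslice : ∀ f, ∃ g, Q g = Q f ∧ Sc g ≤ Scc f) (μ : W) :
    blockSpin Q Sc μ = blockSpin Q Scc μ := by
  have hSc0 : ∀ f, 0 ≤ Sc f := fun f => (hScc0 f).trans (hle f)
  by_cases hne : (fib Q μ).Nonempty
  · refine le_antisymm ?_ (blockSpin_mono hne hScc0 hle)
    refine le_blockSpin hne fun f hf => ?_
    obtain ⟨g, hgQ, hg⟩ := hslice f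
    exact (blockSpin_le hSc0 (show Q g = μ by rw [hgQ, hf])).trans hg
  · rw [Set.not_nonempty_iff_eq_empty] at hne
    simp [blockSpin, hne]

end Abstract

/-! ## §2 At `U = 1`: the value of Bałaban's gauge-fixed vector form is the gauge-invariant value -/

section Flat

variable {d : ℕ} {E : Type*} [NormedAddCommGroup E] [InnerProductSpace ℂ E] [CompleteSpace E] [FiniteDimensional ℂ E]
variable (n : ℕ) [NeZero n] (M : Fin d → ℕ) [hM : ∀ μ, NeZero (M μ)]

/-- **DECISION (D1) AS A THEOREM AT `U = 1`**: over every fibre of the flat line-sum average (product line transports `lineT 1 1`) the block-spin value of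
`ScV n M 1 (projG 1 (ker Q′_1))` equals that of the pure curl form `ScV n M 1 0`. [folklore] -/
theorem blockSpin_projG_flat_eq (φ : Tor M → Fin d → E) :
    blockSpin (QvL n M (lineT n M (fun _ => (1 : E →L[ℂ] E)) (fun _ _ => (1 : E →L[ℂ] E))))
        (ScV n M (fun _ _ => (1 : E →L[ℂ] E)) (projG (fine n M) (fun _ _ => (1 : E →L[ℂ] E)) (kerAvgFlat n M))) φ
      = blockSpin (QvL n M (lineT n M (fun _ => (1 : E →L[ℂ] E)) (fun _ _ => (1 : E →L[ℂ] E))))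
        (ScV n M (fun _ _ => (1 : E →L[ℂ] E)) (fun _ => 0)) φ := by
  refine blockSpin_eq_of_slice (ScV_nonneg n M _ fun _ => le_rfl) (fun W => ?_) (fun W => ?_) φ
  · have h0 := projG_nonneg (fine n M) (fun _ _ => (1 : E →L[ℂ] E)) (kerAvgFlat n M) W
    unfold ScV; gcongr
  · obtain ⟨Ws, hQ, hcurl, hG⟩ := slice_flat n M W
    refine ⟨Ws, hQ, le_of_eq ?_⟩
    simp only [ScV, hcurl, hG]

omit hM in
/-- the same with the constant line transports `fun _ _ _ _ ↦ 1`. [folklore] -/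
theorem blockSpin_projG_flat_eq' [∀ μ, NeZero (M μ)] (φ : Tor M → Fin d → E) :
    blockSpin (QvL n M (fun _ _ _ _ => (1 : E →L[ℂ] E)))
        (ScV n M (fun _ _ => (1 : E →L[ℂ] E)) (projG (fine n M) (fun _ _ => (1 : E →L[ℂ] E)) (kerAvgFlat n M))) φ
      = blockSpin (QvL n M (fun _ _ _ _ => (1 : E →L[ℂ] E))) (ScV n M (fun _ _ => (1 : E →L[ℂ] E)) (fun _ => 0)) φ := by
  have h := blockSpin_projG_flat_eq n M φ
  rwa [lineT_flat] at h

end Flat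

end Summit.QuantumFields.BalabanUV.T4Continuum.VariationalVectorGaugeSliceValue

end
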